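import Summits.ResolutionOfSingularities.ResolutionOfSingularities.Theorems.MarkedTransferCampaignW46MohWindowShadeFormalStepCore
import HarnessLib

/-!
# [OURS · L1 W4.6 rung (iii-2), FORMAL ENTRANCE DOOR, brick 2b] The origin of the `z`-chart over a formally anchored point is never singular

Cell `res-hironaka`, LADDER-RESOLUTION rung L (D-0089), slot W4.6 rung (iii); seat res-L1-s46-pv-6 (gen 5). Host route MarkedTransfer,
`--supports stmt-ResolutionOfSingularities-16155 --as helper`; kind proof (no definition).

WHAT (`not_mem_maximalIdeal_transform_of_zChart`, ring level, pattern of res-L1-s46-pv-2's lemma of the same name for atoms): with chart data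
in the chart of the fibre variable `z` and all `u`-coordinates of the point in `𝔪` (the ORIGIN of the `z`-chart), the controlled transform of
a formally anchored `f₀`, `E₀(f₀) = w₀ · (z^p + F(u))`, all monomials of `F` of degree `≥ p`, is a UNIT: in Cohen coordinates the total transform
is `z^p · (1 + m)`, `m ∈ 𝔪`, because each monomial `u^d` (`|d| ≥ p`) goes to `z^|d| · u^d` (`exists_subst_rename_eq_X_pow_mul`). Hence a
SINGULAR point over an anchored point is always read in a `u`-chart (brick 2c). `K : Type`.

HONEST FRAMING. Nothing here is a statement of H. Hironaka's manuscript [Hironaka2017] (Def. 2.1 p.5 — scope only, under adjudication) and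
nothing asserts that any statement of it holds. AI-written; AI review is weaker than expert review. No `sorry`; axioms standard.
References: H. Matsumura, *Commutative Ring Theory* (1986), Thm. 8.11. [Matsumura1987] [folklore]
-/

noncomputable section

set_option linter.dupNamespace false -- mandated namespace of this single-conjunct summit

open IsLocalRing MvPolynomial

namespace Summit.ResolutionOfSingularities.ResolutionOfSingularities.Theorems

namespace CampaignW46

namespace MohWindowShadeFormalStep

open Literature.AlgebraicGeometry.Resolution
open Literature.AlgebraicGeometry.Resolution.PointBlowup
open Literature.AlgebraicGeometry.Resolution.Hauser2010
open Literature.Barriers.ResolutionOfSingularities.HauserPerlega (natCast_le_ordZero_iff ordZero_ne_top ordZero_rename)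
open CampaignW46.FormalChart
open CampaignW46.AtomGerm (hasSubst_chartGerm ringHom_eq_subst_chartGerm rename_chartSubst_self rename_chartSubst_of_ne
  exists_isUnit_image_adapted X_some_ne_zero kill_rename_some constantCoeff_rename_some mem_maximalIdeal_pow_iff_algebraMap)
open Literature.RingTheory.MvPowerSeries.Jets (mem_maximalIdeal_iff_constantCoeff_eq_zero)
open Summit.ResolutionOfSingularities.ResolutionOfSingularities.Theorems.FrobeniusClosing (chartSubst)
open MohWindowShadeFormalAnchor (frame_apply isRegularLocalRing_S spanFinrank_S span_frame_eq_maximalIdeal eval₂_frame_eq_rename)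
/-! ## §3 The origin of the `z`-chart is never singular (ring level) -/

section ZChart

variable {p : ℕ} [hp : Fact p.Prime] {K : Type} [Field K]
  {R : Type} [CommRing R] [IsLocalRing R] [IsNoetherianRing R]
  {L : Type} [CommRing L] [IsLocalRing L] [IsNoetherianRing L]
  (g : R →+* L) (hg : (maximalIdeal R).map g ≤ maximalIdeal L)
  (E₀ : AdicCompletion (maximalIdeal R) R ≃+* MvPowerSeries (Option (Fin 2)) K)
  (c : Option (Fin 2) → R) (hc : Ideal.span (Set.range c) = maximalIdeal R)
  (hcX : ∀ j, E₀ (algebraMap R (AdicCompletion (maximalIdeal R) R) (c j)) - MvPowerSeries.X j ∈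
    maximalIdeal (MvPowerSeries (Option (Fin 2)) K) ^ 2)
  (e : Option (Fin 2) → L) (he : ∀ j, g (c j) = g (c none) * e j)
  (τ : Option (Fin 2) → R)
  (hgen : Ideal.span (Set.range fun j : Option (Fin 2) =>
    if j = none then g (c none) else e j - g (τ j)) = maximalIdeal L)
  (hres : ∀ y : L, ∃ r : R, y - g r ∈ maximalIdeal L)
  (hdim : (Fintype.card (Option (Fin 2)) : WithBot ℕ∞) ≤ ringKrullDim L)

omit hp in
/-- Under a substitution with `σ(u_l) = z · u_l`, a placed polynomial all of whose monomials have degree `≥ p` goes to `z^p · m` with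
`m ∈ 𝔪`. [folklore] -/
theorem exists_subst_rename_eq_X_pow_mul {σ : Option (Fin 2) → MvPowerSeries (Option (Fin 2)) K} (hσsub : MvPowerSeries.HasSubst σ)
    (hσl : ∀ l : Fin 2, σ (some l) = MvPowerSeries.X none * MvPowerSeries.X (some l)) (hp0 : 0 < p)
    (G : MvPolynomial (Fin 2) K) (hG : ∀ d ∈ G.support, p ≤ d.degree) :
    ∃ m : MvPowerSeries (Option (Fin 2)) K, m ∈ maximalIdeal (MvPowerSeries (Option (Fin 2)) K) ∧
      MvPowerSeries.subst σ (MvPowerSeries.rename (some : Fin 2 → Option (Fin 2)) (G : MvPowerSeries (Fin 2) K)) =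
        MvPowerSeries.X none ^ p * m := by
  classical
  induction G using MvPolynomial.monomial_add_induction_on with
  | C a =>
    by_cases ha : a = 0
    · subst ha
      exact ⟨0, Ideal.zero_mem _, by
        rw [MvPolynomial.C_0, MvPolynomial.coe_zero, map_zero, ← MvPowerSeries.substAlgHom_apply hσsub, map_zero, mul_zero]⟩
    · exfalso
      have h0 : (0 : Fin 2 →₀ ℕ) ∈ (MvPolynomial.C a : MvPolynomial (Fin 2) K).support := by
        rw [MvPolynomial.mem_support_iff, MvPolynomial.coeff_C, if_pos rfl]; exact ha
      have := hG 0 h0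
      rw [map_zero] at this
      exact absurd this (not_le.mpr hp0)
  | monomial_add d a G hd ha0 ih =>
    have hsuppG : ∀ d' ∈ G.support, p ≤ d'.degree := by
      intro d' hd'
      refine hG d' ?_
      rw [MvPolynomial.mem_support_iff, MvPolynomial.coeff_add, MvPolynomial.coeff_monomial]
      have hne : d ≠ d' := by
        rintro rfl
        exact (MvPolynomial.mem_support_iff.mp hd') (MvPolynomial.notMem_support_iff.mp hd)
      rw [if_neg hne, zero_add]
      exact MvPolynomial.mem_support_iff.mp hd'
    obtain ⟨m, hm, hmeq⟩ := ih hsuppG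
    have hdp : p ≤ d.degree := by
      refine hG d ?_
      rw [MvPolynomial.mem_support_iff, MvPolynomial.coeff_add, MvPolynomial.coeff_monomial, if_pos rfl]
      rw [MvPolynomial.notMem_support_iff.mp hd, add_zero]; exact ha0
    -- the monomial: `subst σ (a · u^d) = a · ∏ (z u_l)^{d_l} = a · z^{|d|} · u^d`
    have hmono : MvPowerSeries.subst σ (MvPowerSeries.rename (some : Fin 2 → Option (Fin 2))
        ((MvPolynomial.monomial d a : MvPolynomial (Fin 2) K) : MvPowerSeries (Fin 2) K)) =
        MvPowerSeries.X none ^ p * (MvPowerSeries.C a * MvPowerSeries.X none ^ (d.degree - p) *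
          d.prod fun l k => MvPowerSeries.X (some l) ^ k) := by
      rw [MvPolynomial.coe_monomial, MvPowerSeries.rename_monomial, MvPowerSeries.subst_monomial hσsub,
        Finsupp.prod_mapDomain_index_inj (Option.some_injective _)]
      have h1 : (d.prod fun l n => σ (some l) ^ n) =
          MvPowerSeries.X none ^ d.degree * d.prod fun l k => (MvPowerSeries.X (some l) : MvPowerSeries (Option (Fin 2)) K) ^ k := by
        simp only [hσl, mul_pow]
        rw [Finsupp.prod_mul]
        congr 1
        rw [Finsupp.degree_apply, Finsupp.prod]
        exact Finset.prod_pow_eq_pow_sum d.support d (MvPowerSeries.X none)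
      have h2 : MvPowerSeries.X none ^ d.degree = (MvPowerSeries.X none ^ p * MvPowerSeries.X none ^ (d.degree - p) :
          MvPowerSeries (Option (Fin 2)) K) := by rw [← pow_add, Nat.add_sub_cancel' hdp]
      rw [h1, h2, MvPowerSeries.algebraMap_apply, Algebra.algebraMap_self, RingHom.id_apply]
      ring
    refine ⟨MvPowerSeries.C a * MvPowerSeries.X none ^ (d.degree - p) * (d.prod fun l k => MvPowerSeries.X (some l) ^ k) + m,
      Ideal.add_mem _ ?_ hm, ?_⟩
    · -- the cofactor of the monomial is in `𝔪`: `d ≠ 0`, so some `u_l` divides it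
      have hd0 : d ≠ 0 := by
        rintro rfl; rw [map_zero] at hdp; exact absurd hdp (not_le.mpr hp0)
      obtain ⟨l, hl⟩ := Finsupp.ne_iff.mp hd0
      have hXl : (MvPowerSeries.X (some l) : MvPowerSeries (Option (Fin 2)) K) ^ d l ∈
          maximalIdeal (MvPowerSeries (Option (Fin 2)) K) := by
        refine Ideal.pow_mem_of_mem _ (mem_maximalIdeal_iff_constantCoeff_eq_zero.mpr (MvPowerSeries.constantCoeff_X _)) _ ?_
        exact Nat.pos_of_ne_zero (by simpa using hl)
      have hprod : (d.prod fun l k => (MvPowerSeries.X (some l) : MvPowerSeries (Option (Fin 2)) K) ^ k) ∈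
          maximalIdeal (MvPowerSeries (Option (Fin 2)) K) := by
        rw [Finsupp.prod, ← Finset.prod_erase_mul _ _ (Finsupp.mem_support_iff.mpr hl)]
        exact Ideal.mul_mem_left _ _ hXl
      exact Ideal.mul_mem_left _ _ hprod
    · rw [MvPolynomial.coe_add, map_add, ← MvPowerSeries.substAlgHom_apply hσsub, map_add, MvPowerSeries.substAlgHom_apply,
        MvPowerSeries.substAlgHom_apply, hmono, hmeq]
      ring

include hg hc he hcX hgen hres hdim in
/-- [OURS · L1 W4.6 rung (iii-2) — FORMAL ENTRANCE DOOR; NOT a statement of the manuscript] **The ORIGIN of the `z`-chart over a formally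
anchored point is not singular**: if the point upstairs lies in the chart of the fibre variable `z` with all `u`-coordinates `τ_{u_j} ∈ 𝔪`
(the origin of that chart), then the controlled transform `f′` of `f₀`, `E₀(f₀) = w₀ · (z^p + F(u))` with all monomials of `F` of degree
`≥ p`, is a UNIT: in Cohen coordinates the total transform is `z^p · (unit)` because `F(z·u) ∈ z^p · 𝔪`. So a singular point over an
anchored point is always read in a `u`-chart. (Pattern of res-L1-s46-pv-2's `not_mem_maximalIdeal_transform_of_zChart`.)
[cite: Matsumura1987, Thm. 8.11] [folklore] -/
theorem not_mem_maximalIdeal_transform_of_zChart (hτ𝔪 : ∀ j : Fin 2, τ (some j) ∈ maximalIdeal R)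
    (F : MvPolynomial (Fin 2) K) (hdeg : ∀ d ∈ F.support, p ≤ d.degree) (f₀ : R)
    (w₀ : MvPowerSeries (Option (Fin 2)) K) (hw₀ : IsUnit w₀)
    (hf₀ : E₀ (algebraMap R (AdicCompletion (maximalIdeal R) R) f₀) =
      w₀ * (MvPowerSeries.X none ^ p + MvPolynomial.eval₂ MvPowerSeries.C
        (fun l : Fin 2 => if l = (0 : Fin 2) then MvPowerSeries.X (some (0 : Fin 2)) else MvPowerSeries.X (some 1)) F))
    (f' : L) (hf' : g f₀ = g (c none) ^ p * f') : f' ∉ maximalIdeal L := by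
  classical
  intro hf'𝔪
  set ĝ := adicCompletionMap (maximalIdeal R) (maximalIdeal L) g hg with hĝ
  set φ : MvPowerSeries (Option (Fin 2)) K →+* AdicCompletion (maximalIdeal L) L := ĝ.comp E₀.symm.toRingHom with hφ
  set ofL := algebraMap L (AdicCompletion (maximalIdeal L) L) with hofL
  set ofR := algebraMap R (AdicCompletion (maximalIdeal R) R) with hofR
  have hφE₀ : ∀ x, φ (E₀ x) = ĝ x := fun x => by
    rw [hφ, RingHom.comp_apply]
    change ĝ (E₀.symm (E₀ x)) = ĝ x
    rw [RingEquiv.symm_apply_apply]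
  have hĝ_of : ∀ x : R, ĝ (ofR x) = ofL (g x) := fun x => by
    rw [hofR, hofL, hĝ, adicCompletionMap_algebraMap]
  haveI : IsNoetherianRing (AdicCompletion (maximalIdeal L) L) := isNoetherianRing_adicCompletion_maximalIdeal L
  -- the plain chart at the origin of the `z`-chart: all constants `τ_j(0)` vanish
  obtain ⟨E, hEC, hEi, hEj⟩ := exists_ringEquiv_completion_chart g hg E₀ c hc hcX none e he τ hgen hres hdim
  have hτ0 : ∀ j : Fin 2, MvPowerSeries.constantCoeff (E₀ (ofR (τ (some j)))) = 0 := fun j =>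
    mem_maximalIdeal_iff_constantCoeff_eq_zero.mp (ringEquiv_mem_maximalIdeal E₀
      (by rw [AdicCompletion.maximalIdeal_eq_map]; exact Ideal.mem_map_of_mem _ (hτ𝔪 j)))
  set σ : Option (Fin 2) → MvPowerSeries (Option (Fin 2)) K := fun j =>
    if j = none then MvPowerSeries.X none else MvPowerSeries.X none * (MvPowerSeries.X j + MvPowerSeries.C ((fun _ => (0 : K)) j))
    with hσ
  have hσsub : MvPowerSeries.HasSubst σ := hasSubst_chart none (fun _ => (0 : K))
  set ψ : MvPowerSeries (Option (Fin 2)) K →+* MvPowerSeries (Option (Fin 2)) K := (E : _ →+* _).comp φ with hψ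
  have hψapp : ∀ x, ψ x = E (φ x) := fun x => rfl
  have hψsubst : ∀ f, ψ f = MvPowerSeries.subst σ f := by
    intro f
    refine ringHom_eq_subst_of_apply_X ψ hEC none (fun _ => (0 : K)) hEi (fun j hj => ?_) f
    rw [hψapp, hEj j hj]
    cases j with
    | none => exact absurd rfl hj
    | some k => rw [hτ0 k]
  have hσnone : σ none = MvPowerSeries.X none := by rw [hσ]; simp
  have hσl : ∀ l : Fin 2, σ (some l) = MvPowerSeries.X none * MvPowerSeries.X (some l) := by
    intro l; rw [hσ]; simp
  have hσX : ∀ j, σ j ∈ Ideal.span {(MvPowerSeries.X none : MvPowerSeries (Option (Fin 2)) K)} := by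
    intro j
    cases j with
    | none => rw [hσnone]; exact Ideal.subset_span rfl
    | some l => rw [hσl l]; exact Ideal.mul_mem_right _ _ (Ideal.subset_span rfl)
  -- `ψ(F(u)) = z^p · m`, `m ∈ 𝔪`
  obtain ⟨m, hm, hψFeq⟩ := exists_subst_rename_eq_X_pow_mul hσsub hσl hp.out.pos F hdeg
  have hψF : ψ (MvPolynomial.eval₂ MvPowerSeries.C
      (fun l : Fin 2 => if l = (0 : Fin 2) then MvPowerSeries.X (some (0 : Fin 2)) else MvPowerSeries.X (some 1)) F) =
      MvPowerSeries.X none ^ p * m := by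
    rw [hψsubst, eval₂_frame_eq_rename, hψFeq]
  -- the total transform: `E (g f₀) = ψ(w₀) · z^p · (1 + m)`
  have hEgf₀ : E (ofL (g f₀)) = ψ w₀ * (MvPowerSeries.X none ^ p * (1 + m)) := by
    rw [← hĝ_of, ← hφE₀, ← hψapp, hf₀, map_mul, map_add, map_pow, hψF, hψsubst (MvPowerSeries.X none),
      MvPowerSeries.subst_X hσsub, hσnone]
    ring
  -- `E (g c_none) = z · unit`
  obtain ⟨w₁, hw₁, hEc⟩ : ∃ w₁ : MvPowerSeries (Option (Fin 2)) K, IsUnit w₁ ∧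
      E (ofL (g (c none))) = MvPowerSeries.X none * w₁ := by
    obtain ⟨bb, hbb⟩ := Ideal.mem_span_singleton'.1
      (AtomGerm.subst_mem_span_pow_of_mem_maximalIdeal_pow hσsub hσX (hcX none))
    refine ⟨1 + MvPowerSeries.X none * bb, ?_, ?_⟩
    · rw [MvPowerSeries.isUnit_iff_constantCoeff, map_add, map_one, map_mul, MvPowerSeries.constantCoeff_X (R := K), zero_mul, add_zero]
      exact isUnit_one
    · rw [← hĝ_of, ← hφE₀, ← hψapp, hψsubst]
      have h1 : MvPowerSeries.subst σ (E₀ (ofR (c none))) =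
          MvPowerSeries.subst σ (E₀ (ofR (c none)) - MvPowerSeries.X none) +
            MvPowerSeries.subst σ (MvPowerSeries.X none : MvPowerSeries (Option (Fin 2)) K) := by
        rw [← MvPowerSeries.substAlgHom_apply hσsub, ← MvPowerSeries.substAlgHom_apply hσsub, ← MvPowerSeries.substAlgHom_apply hσsub,
          ← map_add, sub_add_cancel]
      rw [h1, ← hbb, MvPowerSeries.subst_X hσsub, hσnone]; ring
  -- cancel `z^p`: `w₁^p · E f′ = ψ(w₀) · (1 + m)` is a unit
  have hEf' : w₁ ^ p * E (ofL f') = ψ w₀ * (1 + m) := by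
    have h1 : E (ofL (g f₀)) = (MvPowerSeries.X none * w₁) ^ p * E (ofL f') := by
      rw [hf', map_mul, map_pow, map_mul, map_pow, hEc]
    have h2 : (MvPowerSeries.X none : MvPowerSeries (Option (Fin 2)) K) ^ p * (w₁ ^ p * E (ofL f')) =
        MvPowerSeries.X none ^ p * (ψ w₀ * (1 + m)) := by
      rw [← mul_assoc, ← mul_pow, ← h1, hEgf₀]; ring
    refine mul_left_cancel₀ (pow_ne_zero p ?_) h2
    intro h
    have := congrArg (MvPowerSeries.coeff (Finsupp.single (none : Option (Fin 2)) 1)) h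
    rw [MvPowerSeries.coeff_index_single_self_X, map_zero] at this
    exact one_ne_zero this
  have hunit : IsUnit (E (ofL f')) := by
    have h1m : IsUnit (1 + m) := by
      rw [MvPowerSeries.isUnit_iff_constantCoeff, map_add, map_one, mem_maximalIdeal_iff_constantCoeff_eq_zero.mp hm, add_zero]
      exact isUnit_one
    have hu : IsUnit (w₁ ^ p * E (ofL f')) := by rw [hEf']; exact (hw₀.map ψ).mul h1m
    exact isUnit_of_mul_isUnit_right hu
  -- but `f′ ∈ 𝔪_L` makes `E f′ ∈ 𝔪`
  have hmem : E (ofL f') ∈ maximalIdeal (MvPowerSeries (Option (Fin 2)) K) := by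
    refine ringEquiv_mem_maximalIdeal E ?_
    rw [AdicCompletion.maximalIdeal_eq_map]
    exact Ideal.mem_map_of_mem _ hf'𝔪
  exact (IsLocalRing.mem_maximalIdeal _).mp hmem hunit

end ZChart

end MohWindowShadeFormalStep

end CampaignW46

end Summit.ResolutionOfSingularities.ResolutionOfSingularities.Theorems

end
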